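import Mathlib

/-!
# The source tower calculus (monochrome form): capacity lemma and value lemmas for all levels

Support file (seat `prim-ineq-gen-7` gen 31; `--supports stmt-CriticalPhenomena-4575`).  Nothing is asserted about the crux; no `sorry`.
Memo: run/shared/lean/prim/prim-ineq-gen-7/FINDING-TOWER-g31.md §1, §4 and PROOF-TOWER-g31.md §3–§4.

In the type-`t` world of a level of the antithetic tower, certificates factor as `full(routes) · open(memberships)`; a route set is a
pair of Booleans (the two route bits of the active type), a SOURCE is `(o, lam, z)` = (open, own old routes, charged), a level-`k`
CONFIGURATION has `2^k - 1` sources (`Cfg k`: `nil`, `node σ₀ Dh Dt`), and the value is the recursion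
`T₀(r;o,z) = [z ∧ o ∧ full r]`, `T_{k+1}(r;o,z;(σ₀,Dh,Dt)) = T_k(r ∨ λ₀;o,z;Dh) + T_k(r;o₀,z₀;Dt) − min_{H} T_k(λ₀;o₀,z₀;H·Dt)`,
the minimum over all HANDED versions of `Dt` (each source: keep, drop the charge, drop both).  We prove, for every `k`:
monotonicity in `r`; the CAPACITY LEMMA `T_k(r;D) − min_H T_k(r';H·D) ≥ −[full r' ∧ ¬ full r]` (via the two explicit handings
(L1), (L2)); and the value lemmas `T_k ≥ −1`, `full r → T_k ≥ 0`, `full r ∧ z ∧ o → T_k ≥ 1`, `z ∧ o → T_k ≥ 0`,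
`T_k = −1 → ¬ full r ∧ (the λ's of D cover both route bits)`.  These are the ingredients of HUB_k / BASE_k for all k (memo §4d).

* `AntitheticTower.cap` — the capacity lemma, all `k`.
* `AntitheticTower.T_ge_neg_one`, `T_full_nonneg`, `T_full_pos`, `T_open_charged_nonneg`, `T_eq_neg_one` — value lemmas, all `k`.
-/

namespace Summit.CriticalPhenomena.PercolationContinuityZ3.Theorems

namespace AntitheticTower

/-- A route set of the active type: the two route bits. -/
abbrev Rt := Bool × Bool

/-- Both route bits present. -/
def full (r : Rt) : Bool := r.1 && r.2

/-- Union of route sets. -/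
def sup (r s : Rt) : Rt := (r.1 || s.1, r.2 || s.2)

/-- A source: open bit, own old routes, charge bit. -/
structure Src where
  /-- the virtual top is open (no blocker of the active type among its memberships) -/
  o : Bool
  /-- its own old routes -/
  lam : Rt
  /-- it is charged (lies in the down-set) -/
  z : Bool
deriving DecidableEq

/-- Configurations: `Cfg k` has `2^k - 1` sources in pre-order `(σ₀, Dh, Dt)`. -/
inductive Cfg : ℕ → Type
  | nil : Cfg 0
  | node : {k : ℕ} → Src → Cfg k → Cfg k → Cfg (k + 1)

/-- Boolean to integer. -/
def bi (b : Bool) : ℤ := if b then 1 else 0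

/-- bi true = 1. -/
@[simp] theorem bi_true : bi true = 1 := rfl
/-- bi false = 0. -/
@[simp] theorem bi_false : bi false = 0 := rfl
/-- `bi` is nonnegative. -/
theorem bi_nonneg (b : Bool) : 0 ≤ bi b := by cases b <;> simp
/-- `bi` is at most one. -/
theorem bi_le_one (b : Bool) : bi b ≤ 1 := by cases b <;> simp

/-- The three handed versions of a source: keep, drop the charge, drop both. -/
def Src.hands (s : Src) : List Src := [s, ⟨s.o, s.lam, false⟩, ⟨s.o, (false, false), false⟩]

/-- All handed versions of a configuration. -/
def hands : (k : ℕ) → Cfg k → List (Cfg k)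
  | 0, .nil => [.nil]
  | k + 1, .node s h t =>
      (s.hands.flatMap fun s' => (hands k h).flatMap fun h' => (hands k t).map fun t' => Cfg.node s' h' t')

/-- Minimum of a list of integers (0 for the empty list, which never occurs). -/
def lmin : List ℤ → ℤ
  | [] => 0
  | x :: xs => xs.foldl min x

/-- A running minimum is below its initial value. -/
theorem foldl_min_le_init (xs : List ℤ) (a : ℤ) : xs.foldl min a ≤ a := by
  induction xs generalizing a with
  | nil => simp
  | cons y ys ih => simp only [List.foldl_cons]; exact le_trans (ih _) (min_le_left _ _)

/-- A running minimum is below every member. -/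
theorem foldl_min_le_mem (xs : List ℤ) (a : ℤ) {x : ℤ} (hx : x ∈ xs) : xs.foldl min a ≤ x := by
  induction xs generalizing a with
  | nil => simp at hx
  | cons y ys ih =>
      simp only [List.foldl_cons]
      rcases List.mem_cons.mp hx with rfl | h
      · exact le_trans (foldl_min_le_init _ _) (min_le_right _ _)
      · exact ih _ h

/-- `lmin` is below every member. -/
theorem lmin_le_of_mem {l : List ℤ} {x : ℤ} (hx : x ∈ l) : lmin l ≤ x := by
  cases l with
  | nil => simp at hx
  | cons y ys =>
      simp only [lmin]
      rcases List.mem_cons.mp hx with rfl | h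
      · exact foldl_min_le_init _ _
      · exact foldl_min_le_mem _ _ h

/-- A running minimum over `xs` started at `a` lies in `a :: xs`. -/
theorem foldl_min_mem_cons (xs : List ℤ) (a : ℤ) : xs.foldl min a ∈ a :: xs := by
  induction xs generalizing a with
  | nil => simp
  | cons y ys ih =>
      simp only [List.foldl_cons, List.mem_cons]
      have h := ih (min a y)
      simp only [List.mem_cons] at h
      rcases h with h | h
      · rw [h]; rcases le_total a y with hle | hle
        · left; exact min_eq_left hle
        · right; left; exact min_eq_right hle
      · right; right; exact h

/-- `lmin` of a nonempty list is a member. -/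
theorem lmin_mem {l : List ℤ} (hl : l ≠ []) : lmin l ∈ l := by
  cases l with
  | nil => exact absurd rfl hl
  | cons y ys => simp only [lmin]; exact foldl_min_mem_cons ys y

/-- The tower value. -/
def T : (k : ℕ) → Rt → Bool → Bool → Cfg k → ℤ
  | 0, r, o, z, .nil => bi (z && o && full r)
  | k + 1, r, o, z, .node s h t =>
      T k (sup r s.lam) o z h + T k r s.o s.z t - lmin ((hands k t).map fun t' => T k s.lam s.o s.z t')

/-- Minimum of the value over all handed versions. -/
def m (k : ℕ) (r : Rt) (o z : Bool) (D : Cfg k) : ℤ := lmin ((hands k D).map fun D' => T k r o z D')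

/-- The capacity functional `C_k(r,r') = T_k(r;D) − min_H T_k(r';H·D)`. -/
def C (k : ℕ) (r r' : Rt) (o z : Bool) (D : Cfg k) : ℤ := T k r o z D - m k r' o z D

/-- Every configuration has a handed version. -/
theorem hands_ne_nil : ∀ (k : ℕ) (D : Cfg k), hands k D ≠ []
  | 0, .nil => by simp [hands]
  | k + 1, .node s h t => by
      have hh := hands_ne_nil k h; have ht := hands_ne_nil k t
      obtain ⟨h', hh'⟩ := List.exists_mem_of_ne_nil _ hh
      obtain ⟨t', ht'⟩ := List.exists_mem_of_ne_nil _ ht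
      apply List.ne_nil_of_mem (a := Cfg.node s h' t')
      simp only [hands, List.mem_flatMap, List.mem_map, Src.hands]
      exact ⟨s, by simp, h', hh', t', ht', rfl⟩

/-- The identity handing. -/
theorem self_mem_hands : ∀ (k : ℕ) (D : Cfg k), D ∈ hands k D
  | 0, .nil => by simp [hands]
  | k + 1, .node s h t => by
      simp only [hands, List.mem_flatMap, List.mem_map, Src.hands]
      exact ⟨s, by simp, h, self_mem_hands k h, t, self_mem_hands k t, rfl⟩

/-- Handings of the parts give a handing of the node. -/
theorem node_mem_hands {k : ℕ} (s : Src) {s' : Src} (hs : s' ∈ s.hands) {h h' t t' : Cfg k}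
    (hh : h' ∈ hands k h) (ht : t' ∈ hands k t) : Cfg.node s' h' t' ∈ hands (k + 1) (Cfg.node s h t) := by
  simp only [hands, List.mem_flatMap, List.mem_map]
  exact ⟨s', hs, h', hh, t', ht, rfl⟩

/-- `m` is attained. -/
theorem m_attained (k : ℕ) (r : Rt) (o z : Bool) (D : Cfg k) : ∃ D' ∈ hands k D, m k r o z D = T k r o z D' := by
  have hne : ((hands k D).map fun D' => T k r o z D') ≠ [] := by simpa using hands_ne_nil k D
  have := lmin_mem hne
  simp only [List.mem_map] at this
  obtain ⟨D', hD', hval⟩ := this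
  exact ⟨D', hD', by simp [m, hval]⟩

/-- `m` is below the value of every handed version. -/
theorem m_le_of_mem {k : ℕ} {r : Rt} {o z : Bool} {D D' : Cfg k} (hD' : D' ∈ hands k D) : m k r o z D ≤ T k r o z D' :=
  lmin_le_of_mem (List.mem_map.mpr ⟨D', hD', rfl⟩)

/-- `m ≤ T` (identity handing). -/
theorem m_le_T (k : ℕ) (r : Rt) (o z : Bool) (D : Cfg k) : m k r o z D ≤ T k r o z D := m_le_of_mem (self_mem_hands k D)

/-- `C(x,x) ≥ 0`. -/
theorem C_self_nonneg (k : ℕ) (r : Rt) (o z : Bool) (D : Cfg k) : 0 ≤ C k r r o z D := by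
  unfold C; have := m_le_T k r o z D; omega

/-- Handing a source is transitive. -/
theorem Src.hands_trans {s s' s'' : Src} (h1 : s' ∈ s.hands) (h2 : s'' ∈ s'.hands) : s'' ∈ s.hands := by
  simp only [Src.hands, List.mem_cons, List.mem_nil_iff, or_false] at *
  rcases h1 with rfl | rfl | rfl <;> rcases h2 with rfl | rfl | rfl <;> simp

/-- Handing is transitive: a handed version of a handed version is a handed version. -/
theorem hands_trans : ∀ (k : ℕ) (D D' D'' : Cfg k), D' ∈ hands k D → D'' ∈ hands k D' → D'' ∈ hands k D
  | 0, .nil, .nil, .nil, _, _ => by simp [hands]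
  | k + 1, .node s h t, D', D'', h1, h2 => by
      simp only [hands, List.mem_flatMap, List.mem_map] at h1
      obtain ⟨s', hs', h', hh', t', ht', rfl⟩ := h1
      simp only [hands, List.mem_flatMap, List.mem_map] at h2
      obtain ⟨s'', hs'', h'', hh'', t'', ht'', rfl⟩ := h2
      exact node_mem_hands s (Src.hands_trans hs' hs'') (hands_trans k h h' h'' hh' hh'') (hands_trans k t t' t'' ht' ht'')

/-- A minimum over the handed versions of a handed version is at least the minimum over all handed versions. -/
theorem m_le_m_of_mem {k : ℕ} (r : Rt) (o z : Bool) {D D' : Cfg k} (hD' : D' ∈ hands k D) : m k r o z D ≤ m k r o z D' := by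
  obtain ⟨D'', hD'', hval⟩ := m_attained k r o z D'
  rw [hval]
  exact m_le_of_mem (hands_trans k D D' D'' hD' hD'')

/-- The all-dropped version of a configuration. -/
def zero : (k : ℕ) → Cfg k → Cfg k
  | 0, .nil => .nil
  | k + 1, .node s h t => .node ⟨s.o, (false, false), false⟩ (zero k h) (zero k t)

/-- The all-dropped version is a handed version. -/
theorem zero_mem_hands : ∀ (k : ℕ) (D : Cfg k), zero k D ∈ hands k D
  | 0, .nil => by simp [hands, zero]
  | k + 1, .node s h t => by
      simp only [zero]
      exact node_mem_hands s (by simp [Src.hands]) (zero_mem_hands k h) (zero_mem_hands k t)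

/-- Handed versions of the all-dropped version are the all-dropped version. -/
theorem hands_zero : ∀ (k : ℕ) (D D' : Cfg k), D' ∈ hands k (zero k D) → D' = zero k D
  | 0, .nil, .nil, _ => rfl
  | k + 1, .node s h t, D', hD' => by
      simp only [zero, hands, List.mem_flatMap, List.mem_map, Src.hands, List.mem_cons, List.mem_nil_iff, or_false] at hD'
      obtain ⟨s', hs', h', hh', t', ht', rfl⟩ := hD'
      have e1 := hands_zero k h h' hh'; have e2 := hands_zero k t t' ht'
      subst e1; subst e2
      rcases hs' with rfl | rfl | rfl <;> rfl

/-- Union with the empty route set. -/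
@[simp] theorem sup_ff (r : Rt) : sup r (false, false) = r := by simp [sup]

/-- An uncharged root over an all-dropped configuration has value 0. -/
theorem T_zero : ∀ (k : ℕ) (r : Rt) (o : Bool) (D : Cfg k), T k r o false (zero k D) = 0
  | 0, r, o, .nil => by simp [T, zero, bi]
  | k + 1, r, o, .node s h t => by
      simp only [zero, T, sup_ff]
      rw [T_zero k r o h, T_zero k r s.o t]
      have : lmin ((hands k (zero k t)).map fun t' => T k (false, false) s.o false t') = 0 := by
        have hmem := lmin_mem (l := (hands k (zero k t)).map fun t' => T k (false, false) s.o false t')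
          (by simpa using hands_ne_nil k (zero k t))
        simp only [List.mem_map] at hmem
        obtain ⟨t', ht', hval⟩ := hmem
        rw [← hval, hands_zero k t t' ht', T_zero k _ s.o t]
      rw [this]; simp

/-- The minimum over handed versions of an all-dropped configuration with uncharged root is 0. -/
theorem m_zero (k : ℕ) (r : Rt) (o : Bool) (D : Cfg k) : m k r o false (zero k D) = 0 := by
  obtain ⟨D', hD', hval⟩ := m_attained k r o false (zero k D)
  rw [hval, hands_zero k D D' hD', T_zero]

/-- Monotonicity of `T` in the routes. -/
theorem T_mono : ∀ (k : ℕ) (r r' : Rt) (o z : Bool) (D : Cfg k),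
    (r.1 = true → r'.1 = true) → (r.2 = true → r'.2 = true) → T k r o z D ≤ T k r' o z D
  | 0, r, r', o, z, .nil, h1, h2 => by
      simp only [T, full]
      rcases r with ⟨r1, r2⟩; rcases r' with ⟨r1', r2'⟩
      cases r1 <;> cases r2 <;> cases r1' <;> cases r2' <;> cases z <;> cases o <;> simp_all [bi]
  | k + 1, r, r', o, z, .node s h t, h1, h2 => by
      simp only [T]
      have a := T_mono k (sup r s.lam) (sup r' s.lam) o z h (by simp [sup]; tauto) (by simp [sup]; tauto)
      have b := T_mono k r r' s.o s.z t h1 h2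
      omega

/-- The recursion in capacity form: `T_{k+1}(r) = T_k(r ∨ λ₀; Dh) + C_k(r, λ₀; Dt)`. -/
theorem T_succ (k : ℕ) (r : Rt) (o z : Bool) (s : Src) (h t : Cfg k) :
    T (k + 1) r o z (.node s h t) = T k (sup r s.lam) o z h + C k r s.lam s.o s.z t := by
  simp only [T, C, m]; ring

/-- (L1′): keep `σ₀`, minimize both sub-configurations (handing is transitive). -/
theorem L1 (k : ℕ) (r r' : Rt) (o z : Bool) (s : Src) (h t : Cfg k) :
    C k (sup r s.lam) (sup r' s.lam) o z h + C k r r' s.o s.z t ≤ C (k + 1) r r' o z (.node s h t) := by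
  obtain ⟨h', hh', hvalh⟩ := m_attained k (sup r' s.lam) o z h
  obtain ⟨t', ht', hvalt⟩ := m_attained k r' s.o s.z t
  have hmem : Cfg.node s h' t' ∈ hands (k + 1) (.node s h t) := node_mem_hands s (by simp [Src.hands]) hh' ht'
  have hle := m_le_of_mem (r := r') (o := o) (z := z) hmem
  have hsub : m k s.lam s.o s.z t ≤ m k s.lam s.o s.z t' := m_le_m_of_mem s.lam s.o s.z ht'
  have e1 : m k s.lam s.o s.z t = lmin ((hands k t).map fun u => T k s.lam s.o s.z u) := rfl
  have e2 : m k s.lam s.o s.z t' = lmin ((hands k t').map fun u => T k s.lam s.o s.z u) := rfl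
  simp only [C, T] at *
  rw [hvalh, hvalt]
  omega

/-- (L2): drop `σ₀` and all of `Dt`, minimize over `Dh`. -/
theorem L2 (k : ℕ) (r r' : Rt) (o z : Bool) (s : Src) (h t : Cfg k) :
    C k (sup r s.lam) r' o z h + C k r s.lam s.o s.z t ≤ C (k + 1) r r' o z (.node s h t) := by
  obtain ⟨h', hh', hval⟩ := m_attained k r' o z h
  have hmem : Cfg.node ⟨s.o, (false, false), false⟩ h' (zero k t) ∈ hands (k + 1) (.node s h t) :=
    node_mem_hands s (by simp [Src.hands]) hh' (zero_mem_hands k t)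
  have hle := m_le_of_mem (r := r') (o := o) (z := z) hmem
  have hz1 : T k r' s.o false (zero k t) = 0 := T_zero k r' s.o t
  have hz2 : lmin ((hands k (zero k t)).map fun t' => T k (false, false) s.o false t') = 0 := m_zero k (false, false) s.o t
  simp only [T, sup_ff] at hle
  rw [hz1, hz2] at hle
  simp only [C, T]
  rw [hval]
  have e : m k s.lam s.o s.z t = lmin ((hands k t).map fun t' => T k s.lam s.o s.z t') := rfl
  omega

/-- THE CAPACITY LEMMA (all `k`): `C_k(r,r') ≥ −[full r' ∧ ¬ full r]`. -/
theorem cap : ∀ (k : ℕ) (r r' : Rt) (o z : Bool) (D : Cfg k),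
    -(bi (full r' && !full r)) ≤ C k r r' o z D
  | 0, (r1, r2), (r1', r2'), o, z, .nil => by
      simp only [C, m, hands, List.map, lmin, List.foldl, T, full]
      cases r1 <;> cases r2 <;> cases r1' <;> cases r2' <;> cases z <;> cases o <;> simp [bi]
  | k + 1, (r1, r2), (r1', r2'), o, z, .node ⟨so, (la, lb), sz⟩ h t => by
      have l1 := L1 k (r1, r2) (r1', r2') o z ⟨so, (la, lb), sz⟩ h t
      have l2 := L2 k (r1, r2) (r1', r2') o z ⟨so, (la, lb), sz⟩ h t
      have i1 := cap k (sup (r1, r2) (la, lb)) (sup (r1', r2') (la, lb)) o z h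
      have i2 := cap k (r1, r2) (r1', r2') so sz t
      have i3 := cap k (sup (r1, r2) (la, lb)) (r1', r2') o z h
      have i4 := cap k (r1, r2) (la, lb) so sz t
      simp only [full, sup] at l1 l2 i1 i2 i3 i4 ⊢
      cases r1 <;> cases r2 <;> cases r1' <;> cases r2' <;> cases la <;> cases lb <;> norm_num [bi] at l1 l2 i1 i2 i3 i4 ⊢ <;> omega

/-- `full r → T_k ≥ 0`. -/
theorem T_full_nonneg : ∀ (k : ℕ) (r : Rt) (o z : Bool) (D : Cfg k), full r = true → 0 ≤ T k r o z D
  | 0, r, o, z, .nil, hr => by simp only [T]; exact bi_nonneg _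
  | k + 1, r, o, z, .node s h t, hr => by
      rw [T_succ]
      have a := T_full_nonneg k (sup r s.lam) o z h (by simp [full, sup] at *; rcases r with ⟨r1, r2⟩; simp_all)
      have c := cap k r s.lam s.o s.z t
      rw [hr] at c; simp [bi] at c
      omega

/-- `full r ∧ z ∧ o → T_k ≥ 1`. -/
theorem T_full_pos : ∀ (k : ℕ) (r : Rt) (D : Cfg k), full r = true → 1 ≤ T k r true true D
  | 0, r, .nil, hr => by simp [T, hr]
  | k + 1, r, .node s h t, hr => by
      rw [T_succ]
      have a := T_full_pos k (sup r s.lam) h (by simp [full, sup] at *; rcases r with ⟨r1, r2⟩; simp_all)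
      have c := cap k r s.lam s.o s.z t
      rw [hr] at c; simp [bi] at c
      omega

/-- `T_k ≥ −1`. -/
theorem T_ge_neg_one : ∀ (k : ℕ) (r : Rt) (o z : Bool) (D : Cfg k), -1 ≤ T k r o z D
  | 0, r, o, z, .nil => by simp only [T]; have := bi_nonneg (z && o && full r); omega
  | k + 1, r, o, z, .node s h t => by
      rw [T_succ]
      have a := T_ge_neg_one k (sup r s.lam) o z h
      have c := cap k r s.lam s.o s.z t
      by_cases hl : full s.lam = true
      · -- then `r ∨ λ₀` is full and the first summand is ≥ 0
        have hf : full (sup r s.lam) = true := by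
          rcases r with ⟨r1, r2⟩; rcases s with ⟨so, ⟨l1, l2⟩, sz⟩; simp [full, sup] at *; simp [hl]
        have a0 := T_full_nonneg k (sup r s.lam) o z h hf
        have : -1 ≤ C k r s.lam s.o s.z t := le_trans (by have := bi_le_one (full s.lam && !full r); omega) c
        omega
      · have : 0 ≤ C k r s.lam s.o s.z t := by simp [hl] at c; simpa [bi] using c
        omega

/-- `z ∧ o → T_k ≥ 0` (a charged open root collects the rescue bonus). -/
theorem T_open_charged_nonneg : ∀ (k : ℕ) (r : Rt) (D : Cfg k), 0 ≤ T k r true true D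
  | 0, r, .nil => by simp only [T]; exact bi_nonneg _
  | k + 1, r, .node s h t => by
      rw [T_succ]
      have a := T_open_charged_nonneg k (sup r s.lam) h
      have c := cap k r s.lam s.o s.z t
      by_cases hl : full s.lam = true
      · have hf : full (sup r s.lam) = true := by
          rcases r with ⟨r1, r2⟩; rcases s with ⟨so, ⟨l1, l2⟩, sz⟩; simp [full, sup] at *; simp [hl]
        have a1 := T_full_pos k (sup r s.lam) h hf
        have : -1 ≤ C k r s.lam s.o s.z t := le_trans (by have := bi_le_one (full s.lam && !full r); omega) c
        omega
      · have : 0 ≤ C k r s.lam s.o s.z t := by simp [hl] at c; simpa [bi] using c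
        omega

/-- Union of all own routes `λ_v` of a configuration. -/
def lamU : (k : ℕ) → Cfg k → Rt
  | 0, .nil => (false, false)
  | k + 1, .node s h t => sup s.lam (sup (lamU k h) (lamU k t))

/-- `T_k = −1 → ¬ full r` and the `λ`'s of `D` cover both route bits. -/
theorem T_eq_neg_one : ∀ (k : ℕ) (r : Rt) (o z : Bool) (D : Cfg k), T k r o z D = -1 →
    full r = false ∧ full (lamU k D) = true
  | 0, r, o, z, .nil, h => by simp only [T] at h; have := bi_nonneg (z && o && full r); omega
  | k + 1, (r1, r2), o, z, .node ⟨so, (la, lb), sz⟩ hh t, h => by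
      rw [T_succ] at h
      dsimp only at h
      have a := T_ge_neg_one k (sup (r1, r2) (la, lb)) o z hh
      have c := cap k (r1, r2) (la, lb) so sz t
      have hb := bi_le_one (full (la, lb) && !full (r1, r2))
      rcases hl : lamU k hh with ⟨u1, u2⟩
      rcases hm : lamU k t with ⟨v1, v2⟩
      by_cases hA : T k (sup (r1, r2) (la, lb)) o z hh = -1
      · obtain ⟨ih1, ih2⟩ := T_eq_neg_one k _ o z hh hA
        rw [hl] at ih2
        simp only [lamU, hl, hm, full, sup] at ih1 ih2 ⊢
        cases r1 <;> cases r2 <;> cases la <;> cases lb <;> cases u1 <;> cases u2 <;> simp_all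
      · have hC : C k (r1, r2) (la, lb) so sz t = -1 := by omega
        simp only [lamU, hl, hm, full, sup] at c ⊢
        cases r1 <;> cases r2 <;> cases la <;> cases lb <;> norm_num [bi] at c hC ⊢ <;> omega

end AntitheticTower

end Summit.CriticalPhenomena.PercolationContinuityZ3.Theorems
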